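import Literature.NumberTheory.Sieve.ParityWave0
import Literature.NumberTheory.LFunctions.LiouvilleSumClassicalBound
import Literature.NumberTheory.LFunctions.SiegelWalfiszMoebiusProofs
import HarnessLib

/-!
# Chowla's conjecture (`parity.S06`): the proved cases, and why there is no `_holds`

`Literature.NumberTheory.Sieve.ParityWave0` states Chowla's conjecture twice, as OPEN conjectures
(`def … : Prop`, CONVENTIONS §4 — never asserted):

* `ChowlaConjecture` (Liouville form): for `k ≥ 1` and distinct shifts `h₁, …, h_k`,
  `∑_{n<x} λ(n+h₁) ⋯ λ(n+h_k) = o(x)`;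
* `MoebiusChowlaConjecture` (Möbius sign-pattern form, Sarnak 2010): for distinct shifts and
  exponents `a_i ∈ {1, 2}` not all `2`, `∑_{n<x} μ(n+h₁)^{a₁} ⋯ μ(n+h_k)^{a_k} = o(x)`.

**Status (why this file does not contain `MoebiusChowlaConjecture_holds`).** Both conjectures are
open for every `k ≥ 2` (two or more odd exponents): "Chowla's conjecture remains open for any
`h₁, …, h_k` with `k ≥ 2`" (Matomäki–Radziwiłł–Tao, *An averaged form of Chowla's conjecture*,
§1); "For `ℓ = 1` Chowla's conjecture is equivalent to the prime number theorem, but the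
conjecture is open for all `ℓ ≥ 2`, although a slightly weaker logarithmically averaged conjecture
is known to hold for `ℓ = 2` or for odd `ℓ` … All the discussion here concerning the Liouville
function `λ` has a counterpart for the Möbius function `μ`" (Tao–Teräväinen, *The
Hardy–Littlewood–Chowla conjecture in the presence of a Siegel zero*, §1.1). A discharge
`theorem MoebiusChowlaConjecture_holds` would be a proof of Chowla's conjecture; none exists in
print, so none is vendored (D-0014/D-0026: no weakening, no restatement as a hypothesis).

**What IS proved here** (everything below is a theorem; no new definitions, no named facts):

* `Literature.NumberTheory.Sieve.moebiusChowlaConjecture_oneOdd` — the classical known case of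
  `MoebiusChowlaConjecture`: every sign pattern with EXACTLY ONE odd exponent, for arbitrary
  (not necessarily distinct) shifts, `∑_{n<x} μ(n+h_{i₀}) ∏_{i≠i₀} μ²(n+h_i) = o(x)`; binder-shape
  form `moebiusChowlaConjecture_of_existsUnique`, and the single-shift case
  `moebiusChowlaConjecture_one` (`∑_{n<x} μ(n+h₀) = o(x)`, the prime number theorem for `μ`).
  Inputs: the tree's PROVED Siegel–Walfisz theorem for `μ` in ALL residue classes
  (`Literature.NumberTheory.LFunctions.SiegelWalfiszMoebius_holds`, Montgomery–Vaughan §11.3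
  Exercise 13(f)), used at a fixed modulus (`ChowlaKOne.isLittleO_sum_moebius_progression`), and
  an elementary squarefree sieve: the `μ²` factors impose squarefreeness of the `n + h_i`, which is
  detected up to density `≤ ∑_i 2/(P+1)` by the squares `d²`, `2 ≤ d ≤ P`
  (`ChowlaOneOdd.card_exceptional_le`), a condition periodic modulo `(P!)²`
  (`ChowlaOneOdd.sifted_iff_mod`, `ChowlaOneOdd.main_isLittleO`). Printed form of this
  reduction: Ramaré 2018, Lemma 16.10 and Theorem 16.8 (Conjecture 16.4 ⇒ 16.6), whose case
  `|I| = 1` is the prime number theorem for `μ` in arithmetic progressions.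
* `Literature.NumberTheory.Sieve.chowlaConjecture_one` — the case `k = 1` of the Liouville form,
  `∑_{n<x} λ(n+h₀) = o(x)` ("If `f(x) = x` this is equivalent to the Prime Number Theorem",
  Chowla 1965, Ch. 8), from the tree's unconditional de la Vallée-Poussin–Landau bound
  `Literature.NumberTheory.LFunctions.abs_sum_liouville_le_logPow` (Montgomery–Vaughan §6.2.1
  Exercise 11), turned into `o(x)` along `ℕ` and shifted (`ChowlaKOne.isLittleO_sum_range_of_logBound`,
  `ChowlaKOne.isLittleO_sum_range_add`).

## References

* S. Chowla, *The Riemann Hypothesis and Hilbert's Tenth Problem*, Gordon and Breach 1965, Ch. 8,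
  Problem 57, eq. (341) (locator as printed by Ramaré 2018, §16.1): `∑_{n≤x} λ(f(n)) = o(x)` for
  every `f ∈ ℤ[X]` not of the form `c·g(x)²` — "If `f(x) = x` this is equivalent to the Prime
  Number Theorem"; the `k`-point forms vendored in `ParityWave0` are the case `f = ∏ᵢ (x + hᵢ)`
  [Chowla1965Book].
* P. Sarnak, *Three lectures on the Möbius function randomness and dynamics*, IAS 2010, Lecture 1,
  Conjecture 1 (the sign-pattern form) [Sarnak2010ThreeLectures].
* O. Ramaré, *Chowla's conjecture: from the Liouville function to the Moebius function*, in: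
  Ergodic Theory and Dynamical Systems in their Interactions with Arithmetics and Combinatorics,
  LNM 2213, Springer 2018, Ch. 16, pp. 317–323: Conjectures 16.4/16.6, Theorem 16.8, Lemma 16.10
  [Ramare2018ChowlaLiouvilleMoebius].
* K. Matomäki, M. Radziwiłł, T. Tao, Algebra Number Theory 9 (2015), §1 [MatomakiRadziwillTao2015].
* T. Tao, J. Teräväinen, J. London Math. Soc. 106 (2022), §1.1 [TaoTeravainen2022SiegelZero];
  J. Théor. Nombres Bordeaux 30 (2018), §1 (`∑ λ(an+b) = o(x)` ⟺ PNT in progressions)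
  [TaoTeravainenJTNB2018].
* H. L. Montgomery, R. C. Vaughan, *Multiplicative Number Theory I*, CUP 2007, §6.2 and §11.3
  Exercise 13(f) [MontgomeryVaughan2007].

## Not here

Every case of either conjecture with two or more odd exponents and `k ≥ 2` distinct shifts is
open (see above); the logarithmically averaged results (Tao 2016, Tao–Teräväinen 2018/2019) are
the named facts `tao_log_chowla`, `tao_log_chowla_moebius`, `TaoTeravainen_odd_log_chowla` of
`ParityWave0.lean` and are not touched here.
-/

open Filter Asymptotics Finset
open scoped ArithmeticFunction.Moebius

namespace Literature.NumberTheory.Sieve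

namespace ChowlaKOne

/-- From the classical shape `|∑_{0<n≤x} f(n)| ≤ C x / log x` (`x ≥ X₀` real) of a prime number
theorem for `f` (with `f 0 = 0`) to `∑_{n<y} f(n) = o(y)` along `y → ∞` in `ℕ`. [folklore] -/
theorem isLittleO_sum_range_of_logBound {f : ℕ → ℝ} (hf0 : f 0 = 0)
    (hf : ∃ C X₀ : ℝ, ∀ x : ℝ, X₀ ≤ x → |∑ n ∈ Ioc 0 ⌊x⌋₊, f n| ≤ C * x / Real.log x ^ (1 : ℝ)) :
    (fun y : ℕ => ∑ n ∈ range y, f n) =o[atTop] fun y => (y : ℝ) := by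
  obtain ⟨C, X₀, hC⟩ := hf
  have hlog : Tendsto (fun z : ℕ => Real.log (z : ℝ)) atTop atTop :=
    Real.tendsto_log_atTop.comp tendsto_natCast_atTop_atTop
  -- the statement shifted by one: `∑_{n ≤ z} f(n) = o(z)`
  have h1 : (fun z : ℕ => ∑ n ∈ range (z + 1), f n) =o[atTop] fun z => (z : ℝ) := by
    refine Asymptotics.isLittleO_iff.2 fun ε hε => ?_
    filter_upwards [tendsto_natCast_atTop_atTop.eventually_ge_atTop X₀,
      hlog.eventually_ge_atTop (C / ε), hlog.eventually_gt_atTop 0] with z hzX hzlog hlogpos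
    have hsum : ∑ n ∈ range (z + 1), f n = ∑ n ∈ Ioc 0 z, f n := by
      rw [Nat.range_succ_eq_Icc_zero, Finset.Icc_eq_cons_Ioc (Nat.zero_le z), Finset.sum_cons,
        hf0, zero_add]
    have hb := hC z hzX
    rw [Nat.floor_natCast, Real.rpow_one] at hb
    have hz0 : (0 : ℝ) ≤ z := Nat.cast_nonneg z
    rw [hsum, Real.norm_eq_abs, Real.norm_eq_abs, abs_of_nonneg hz0]
    refine hb.trans ?_
    rw [div_le_iff₀ hlogpos]
    have hCle : C ≤ ε * Real.log z := (div_le_iff₀' hε).1 hzlog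
    nlinarith
  -- unshift along `y ↦ y - 1`
  have h2 := h1.comp_tendsto (tendsto_sub_atTop_nat 1)
  have h3 : (fun y : ℕ => (((y - 1 : ℕ) : ℝ))) =O[atTop] fun y => (y : ℝ) := by
    refine IsBigO.of_bound 1 (Eventually.of_forall fun y => ?_)
    rw [Real.norm_eq_abs, Real.norm_eq_abs, abs_of_nonneg (Nat.cast_nonneg _),
      abs_of_nonneg (Nat.cast_nonneg _), one_mul]
    exact_mod_cast Nat.sub_le y 1
  refine (h2.trans_isBigO h3).congr' ?_ EventuallyEq.rfl
  filter_upwards [eventually_ge_atTop 1] with y hy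
  simp only [Function.comp_apply, Nat.sub_add_cancel hy]

/-- If `∑_{n<y} f(n) = o(y)`, then for every fixed shift `c`, `∑_{n<x} f(n+c) = o(x)`
(the shifted sum is `F(x+c) - F(c)`). [folklore] -/
theorem isLittleO_sum_range_add {f : ℕ → ℝ}
    (hF : (fun y : ℕ => ∑ n ∈ range y, f n) =o[atTop] fun y => (y : ℝ)) (c : ℕ) :
    (fun x : ℕ => ∑ n ∈ range x, f (n + c)) =o[atTop] fun x => (x : ℝ) := by
  -- `F(x + c) = o(x + c) = o(x)`
  have h1 : (fun x : ℕ => ∑ n ∈ range (x + c), f n) =o[atTop] fun x : ℕ => ((x + c : ℕ) : ℝ) :=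
    (hF.comp_tendsto (tendsto_add_atTop_nat c)).congr (fun _ => rfl) fun _ => rfl
  have h2 : (fun x : ℕ => ((x + c : ℕ) : ℝ)) =O[atTop] fun x => (x : ℝ) := by
    refine IsBigO.of_bound 2 ?_
    filter_upwards [eventually_ge_atTop c] with x hx
    rw [Real.norm_eq_abs, Real.norm_eq_abs, abs_of_nonneg (Nat.cast_nonneg _),
      abs_of_nonneg (Nat.cast_nonneg _), Nat.cast_add]
    have hx' : (c : ℝ) ≤ x := by exact_mod_cast hx
    linarith
  -- the constant `F(c) = o(x)`
  have h3 : (fun _ : ℕ => ∑ n ∈ range c, f n) =o[atTop] fun x : ℕ => (x : ℝ) :=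
    isLittleO_const_left.2 (Or.inr (tendsto_norm_atTop_atTop.comp tendsto_natCast_atTop_atTop))
  refine ((h1.trans_isBigO h2).sub h3).congr' (Eventually.of_forall fun x => ?_) EventuallyEq.rfl
  show ∑ n ∈ range (x + c), f n - ∑ n ∈ range c, f n = ∑ n ∈ range x, f (n + c)
  rw [add_comm x c, Finset.sum_range_add, add_sub_cancel_left]
  exact Finset.sum_congr rfl fun n _ => by rw [add_comm]

/-- **The Möbius function in a fixed arithmetic progression, shifted**: for `M ≥ 1`, `r < M` and
any `c`, `∑_{n<x, n ≡ r (M)} μ(n + c) = o(x)` — the prime number theorem for `μ` in arithmetic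
progressions (all residue classes, coprime or not), here from the tree's PROVED Siegel–Walfisz
theorem for `μ`, `Literature.NumberTheory.LFunctions.SiegelWalfiszMoebius_holds`
(Montgomery–Vaughan §11.3 Exercise 13(f)), at the fixed modulus `M ≤ log x`.
[cite: MontgomeryVaughan2007, §11.3 Exercise 13(f) p. 384] -/
theorem isLittleO_sum_moebius_progression {M : ℕ} (hM : 0 < M) {r : ℕ} (hr : r < M) (c : ℕ) :
    (fun x : ℕ => ∑ n ∈ (range x).filter (fun n => n % M = r), (μ (n + c) : ℝ)) =o[atTop]
      fun x => (x : ℝ) := by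
  -- `f = μ · 1_{≡ r + c (M)}`
  set f : ℕ → ℝ := fun m => if m % M = (r + c) % M then (μ m : ℝ) else 0 with hf_def
  have hf0 : f 0 = 0 := by simp [hf_def]
  -- the Siegel–Walfisz input at the fixed modulus `M`
  have hbound : ∃ C X₀ : ℝ, ∀ x : ℝ, X₀ ≤ x →
      |∑ n ∈ Ioc 0 ⌊x⌋₊, f n| ≤ C * x / Real.log x ^ (1 : ℝ) := by
    obtain ⟨c₀, hc₀, hA⟩ := Literature.NumberTheory.LFunctions.SiegelWalfiszMoebius_holds
    obtain ⟨C, hC⟩ := hA 1 one_pos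
    obtain ⟨C', hC'0, hC'⟩ :=
      Literature.NumberTheory.LFunctions.exists_mul_exp_neg_sqrt_log_le c₀ hc₀ 1
    refine ⟨max C 0 * C', max 2 (Real.exp M), fun x hx => ?_⟩
    have hx2 : (2 : ℝ) ≤ x := le_trans (le_max_left _ _) hx
    have hxM : Real.exp M ≤ x := le_trans (le_max_right _ _) hx
    have hM1 : 1 ≤ M := hM
    have hMlog : (M : ℝ) ≤ Real.log x ^ (1 : ℝ) := by
      rw [Real.rpow_one]
      have := Real.log_le_log (Real.exp_pos M) hxM
      rwa [Real.log_exp] at this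
    have hSW := hC x hx2 M hM1 hMlog (((r + c : ℕ) : ZMod M))
    have hset : ∑ n ∈ Ioc 0 ⌊x⌋₊, f n =
        ∑ n ∈ (Icc 1 ⌊x⌋₊).filter (fun n : ℕ => (n : ZMod M) = ((r + c : ℕ) : ZMod M)),
          (μ n : ℝ) := by
      rw [Finset.sum_filter, show (1 : ℕ) = 0 + 1 from rfl, Finset.Icc_add_one_left_eq_Ioc]
      refine Finset.sum_congr rfl fun n _ => ?_
      simp only [hf_def, ZMod.natCast_eq_natCast_iff']
    rw [hset]
    refine hSW.trans ?_
    have h1 : 0 ≤ x * Real.exp (-c₀ * Real.sqrt (Real.log x)) := by positivity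
    calc C * x * Real.exp (-c₀ * Real.sqrt (Real.log x))
        = C * (x * Real.exp (-c₀ * Real.sqrt (Real.log x))) := by ring
      _ ≤ max C 0 * (x * Real.exp (-c₀ * Real.sqrt (Real.log x))) :=
          mul_le_mul_of_nonneg_right (le_max_left _ _) h1
      _ ≤ max C 0 * (C' * x / Real.log x ^ (1 : ℝ)) :=
          mul_le_mul_of_nonneg_left (hC' x hx2) (le_max_right _ _)
      _ = max C 0 * C' * x / Real.log x ^ (1 : ℝ) := by ring
  have hF := isLittleO_sum_range_of_logBound hf0 hbound
  refine (isLittleO_sum_range_add hF c).congr' (Eventually.of_forall fun x => ?_) EventuallyEq.rfl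
  show ∑ n ∈ range x, f (n + c) = ∑ n ∈ (range x).filter (fun n => n % M = r), (μ (n + c) : ℝ)
  rw [Finset.sum_filter]
  refine Finset.sum_congr rfl fun n _ => ?_
  have hiff : (n + c) % M = (r + c) % M ↔ n % M = r := by
    constructor
    · intro h
      have := Nat.ModEq.add_right_cancel' c (h : n + c ≡ r + c [MOD M])
      rw [Nat.ModEq, Nat.mod_eq_of_lt hr] at this
      exact this
    · intro h
      exact Nat.ModEq.add_right c (show n ≡ r [MOD M] by rw [Nat.ModEq, h, Nat.mod_eq_of_lt hr])
  simp only [hf_def, hiff]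

end ChowlaKOne

namespace ChowlaOneOdd

variable {k : ℕ}

/-! ### The summand: `μ(n+h_{i₀}) · 1[all n+h_i squarefree]` -/

/-- `μ(m)² = 1` for squarefree `m`. [folklore] -/
theorem moebius_sq_of_squarefree {m : ℕ} (hm : Squarefree m) : ((μ m : ℝ)) ^ 2 = 1 := by
  rw [ArithmeticFunction.moebius_apply_of_squarefree hm]
  push_cast
  rw [← pow_mul, mul_comm, pow_mul, neg_one_sq, one_pow]

/-- With exactly one exponent `a_{i₀} = 1` and all others `2`, the Chowla summand is
`μ(n + h_{i₀})` times the indicator that every `n + h_i` is squarefree. [folklore] -/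
theorem prod_pow_eq (h a : Fin k → ℕ) (i₀ : Fin k) (ha : a i₀ = 1)
    (ha' : ∀ i, i ≠ i₀ → a i = 2) (n : ℕ) :
    (∏ i, (μ (n + h i) : ℝ) ^ a i) =
      (μ (n + h i₀) : ℝ) * if ∀ i, Squarefree (n + h i) then 1 else 0 := by
  classical
  rw [← Finset.mul_prod_erase univ (fun i => (μ (n + h i) : ℝ) ^ a i) (mem_univ i₀), ha, pow_one]
  by_cases h0 : Squarefree (n + h i₀)
  · congr 1
    split_ifs with hall
    · refine Finset.prod_eq_one fun i hi => ?_
      rw [ha' i (Finset.ne_of_mem_erase hi)]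
      exact moebius_sq_of_squarefree (hall i)
    · push Not at hall
      obtain ⟨j, hj⟩ := hall
      have hj0 : j ≠ i₀ := fun e => hj (by rw [e]; exact h0)
      refine Finset.prod_eq_zero (Finset.mem_erase.2 ⟨hj0, mem_univ j⟩) ?_
      rw [ha' j hj0, ArithmeticFunction.moebius_eq_zero_of_not_squarefree hj]
      simp
  · rw [ArithmeticFunction.moebius_eq_zero_of_not_squarefree h0]
    simp

/-! ### Sifting the squares `d² (2 ≤ d ≤ P)` -/

/-- A squarefree number has no square factor `d²`, `2 ≤ d ≤ P`. [folklore] -/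
theorem sifted_of_squarefree {P m : ℕ} (hm : Squarefree m) :
    ∀ d ∈ Icc 2 P, ¬ d ^ 2 ∣ m := by
  intro d hd hdiv
  have h2 : 2 ≤ d := (mem_Icc.1 hd).1
  have hu := hm d (by rwa [← pow_two])
  rw [Nat.isUnit_iff] at hu
  omega

/-- If `m` has no square factor `d²` with `2 ≤ d ≤ P` (`P ≥ 2`) but is not squarefree, then
`d² ∣ m` for some `P < d ≤ √m`. [folklore] -/
theorem exists_of_sifted_not_squarefree {P m : ℕ} (hP : 2 ≤ P)
    (hs : ∀ d ∈ Icc 2 P, ¬ d ^ 2 ∣ m) (hm : ¬ Squarefree m) :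
    ∃ d, P < d ∧ d ≤ Nat.sqrt m ∧ d ^ 2 ∣ m := by
  have hm0 : m ≠ 0 := by
    rintro rfl
    exact hs 2 (mem_Icc.2 ⟨le_rfl, hP⟩) (dvd_zero _)
  simp only [Squarefree, not_forall] at hm
  obtain ⟨d, hd, hu⟩ := hm
  rw [Nat.isUnit_iff] at hu
  have hd0 : d ≠ 0 := by
    rintro rfl
    rw [zero_mul, zero_dvd_iff] at hd
    exact hm0 hd
  have hd2 : 2 ≤ d := by omega
  rw [← pow_two] at hd
  have hdP : P < d := by
    by_contra hle
    push Not at hle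
    exact hs d (mem_Icc.2 ⟨hd2, hle⟩) hd
  exact ⟨d, hdP, Nat.le_sqrt'.2 (Nat.le_of_dvd (Nat.pos_of_ne_zero hm0) hd), hd⟩

/-- Being `P`-sifted is periodic in `n` with any period `Q` divisible by all `d²`, `2 ≤ d ≤ P`.
[folklore] -/
theorem sifted_iff_mod (h : Fin k → ℕ) {P Q : ℕ} (hQ : ∀ d ∈ Icc 2 P, d ^ 2 ∣ Q) (n : ℕ) :
    (∀ i, ∀ d ∈ Icc 2 P, ¬ d ^ 2 ∣ n + h i) ↔ (∀ i, ∀ d ∈ Icc 2 P, ¬ d ^ 2 ∣ n % Q + h i) := by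
  refine forall_congr' fun i => forall₂_congr fun d hd => not_congr ?_
  have hmod : (n % Q + h i) % (d ^ 2) = (n + h i) % (d ^ 2) :=
    Nat.ModEq.add_right _ ((Nat.mod_modEq n Q).of_dvd (hQ d hd))
  rw [Nat.dvd_iff_mod_eq_zero, Nat.dvd_iff_mod_eq_zero, hmod]

/-! ### Counting the exceptional `n` -/

/-- At most `x/q + 1` of the `n < x` have `q ∣ n + c` (for `q = 0` both sides degenerate
consistently: `ℕ`-division by `0` is `0` and at most one `n` has `n + c = 0`). [folklore] -/
theorem card_filter_dvd_add_le (q x c : ℕ) :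
    (#((range x).filter (fun n => q ∣ n + c)) : ℝ) ≤ (x : ℝ) / q + 1 := by
  have hnat : #((range x).filter (fun n => q ∣ n + c)) ≤ x / q + 1 := by
    have hmaps : Set.MapsTo (fun n => n / q) ↑((range x).filter (fun n => q ∣ n + c))
        ↑(range (x / q + 1)) := by
      intro n hn
      simp only [coe_filter, Set.mem_setOf_eq, mem_range] at hn
      simp only [coe_range, Set.mem_Iio]
      exact Nat.lt_succ_of_le (Nat.div_le_div_right hn.1.le)
    have hinj : Set.InjOn (fun n => n / q) ↑((range x).filter (fun n => q ∣ n + c)) := by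
      intro n hn n' hn' heq
      simp only [coe_filter, Set.mem_setOf_eq, mem_range] at hn hn'
      have hmc : n + c ≡ n' + c [MOD q] :=
        (Nat.mod_eq_zero_of_dvd hn.2).trans (Nat.mod_eq_zero_of_dvd hn'.2).symm
      have hmod : n % q = n' % q := Nat.ModEq.add_right_cancel' c hmc
      have heq' : n / q = n' / q := heq
      calc n = q * (n / q) + n % q := (Nat.div_add_mod n q).symm
        _ = q * (n' / q) + n' % q := by rw [heq', hmod]
        _ = n' := Nat.div_add_mod n' q
    simpa using Finset.card_le_card_of_injOn _ hmaps hinj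
  calc (#((range x).filter (fun n => q ∣ n + c)) : ℝ) ≤ ((x / q + 1 : ℕ) : ℝ) := by
        exact_mod_cast hnat
    _ = ((x / q : ℕ) : ℝ) + 1 := by push_cast; ring
    _ ≤ (x : ℝ) / q + 1 := by gcongr; exact Nat.cast_div_le

/-- `∑_{P < d ≤ D} 1/d² ≤ 2/(P+1)`. [folklore] -/
theorem sum_Ioc_inv_sq_le (P D : ℕ) : ∑ d ∈ Ioc P D, ((d : ℝ) ^ 2)⁻¹ ≤ 2 / ((P : ℝ) + 1) := by
  have hsub : Ioc P D ⊆ Ioo P (D + 1) := fun d hd => by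
    rw [mem_Ioc] at hd
    rw [mem_Ioo]
    omega
  refine (Finset.sum_le_sum_of_subset_of_nonneg hsub fun d _ _ => by positivity).trans ?_
  exact sum_Ioo_inv_sq_le P (D + 1)

/-- The number of `n < x` for which some `n + h_i` has a square factor `d²` with
`P < d ≤ √(x + h_i)` is at most `∑_i (2x/(P+1) + √(x + h_i))`. [folklore] -/
theorem card_exceptional_le (h : Fin k → ℕ) (P x : ℕ) :
    (#((range x).filter (fun n => ∃ i, ∃ d ∈ Ioc P (Nat.sqrt (x + h i)), d ^ 2 ∣ n + h i)) : ℝ) ≤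
      ∑ i, (2 * (x : ℝ) / ((P : ℝ) + 1) + Nat.sqrt (x + h i)) := by
  classical
  have hsub : (range x).filter (fun n => ∃ i, ∃ d ∈ Ioc P (Nat.sqrt (x + h i)), d ^ 2 ∣ n + h i) ⊆
      (univ : Finset (Fin k)).biUnion fun i => (Ioc P (Nat.sqrt (x + h i))).biUnion fun d =>
        (range x).filter (fun n => d ^ 2 ∣ n + h i) := by
    intro n hn
    simp only [mem_filter, mem_range] at hn
    obtain ⟨hnx, i, d, hd, hdvd⟩ := hn
    simp only [mem_biUnion, mem_univ, true_and, mem_filter, mem_range]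
    exact ⟨i, d, hd, hnx, hdvd⟩
  calc (#((range x).filter
          (fun n => ∃ i, ∃ d ∈ Ioc P (Nat.sqrt (x + h i)), d ^ 2 ∣ n + h i)) : ℝ)
      ≤ #((univ : Finset (Fin k)).biUnion fun i => (Ioc P (Nat.sqrt (x + h i))).biUnion fun d =>
          (range x).filter (fun n => d ^ 2 ∣ n + h i)) := by exact_mod_cast card_le_card hsub
    _ ≤ ∑ i, (#((Ioc P (Nat.sqrt (x + h i))).biUnion fun d =>
          (range x).filter (fun n => d ^ 2 ∣ n + h i)) : ℝ) := by
        exact_mod_cast card_biUnion_le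
    _ ≤ ∑ i, ∑ d ∈ Ioc P (Nat.sqrt (x + h i)), (#((range x).filter (fun n => d ^ 2 ∣ n + h i)) : ℝ) :=
        Finset.sum_le_sum fun i _ => by exact_mod_cast card_biUnion_le
    _ ≤ ∑ i, ∑ d ∈ Ioc P (Nat.sqrt (x + h i)), ((x : ℝ) / ((d ^ 2 : ℕ) : ℝ) + 1) := by
        gcongr with i _ d hd
        exact card_filter_dvd_add_le (d ^ 2) x (h i)
    _ ≤ ∑ i, (2 * (x : ℝ) / ((P : ℝ) + 1) + Nat.sqrt (x + h i)) := by
        refine Finset.sum_le_sum fun i _ => ?_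
        rw [Finset.sum_add_distrib, Finset.sum_const, Nat.card_Ioc, nsmul_eq_mul, mul_one]
        refine add_le_add ?_ (by exact_mod_cast Nat.sub_le _ P)
        have hx0 : (0 : ℝ) ≤ x := Nat.cast_nonneg x
        calc ∑ d ∈ Ioc P (Nat.sqrt (x + h i)), (x : ℝ) / ((d ^ 2 : ℕ) : ℝ)
            = (x : ℝ) * ∑ d ∈ Ioc P (Nat.sqrt (x + h i)), ((d : ℝ) ^ 2)⁻¹ := by
              rw [Finset.mul_sum]
              refine Finset.sum_congr rfl fun d _ => ?_
              push_cast
              rw [div_eq_mul_inv]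
          _ ≤ (x : ℝ) * (2 / ((P : ℝ) + 1)) :=
              mul_le_mul_of_nonneg_left (sum_Ioc_inv_sq_le P _) hx0
          _ = 2 * (x : ℝ) / ((P : ℝ) + 1) := by ring

/-! ### The sifted main term is `o(x)` -/

/-- For fixed `P`, `∑_{n<x} μ(n + h_{i₀}) 1[no d² ∣ n+h_i, 2 ≤ d ≤ P] = o(x)`: the sifted
indicator is periodic modulo `Q = (P!)²`, so the sum splits into `≤ Q` sums of `μ` over shifted
arithmetic progressions modulo `Q`, each `o(x)`
(`ChowlaKOne.isLittleO_sum_moebius_progression`). [folklore] -/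
theorem main_isLittleO (h : Fin k → ℕ) (i₀ : Fin k) (P : ℕ) :
    (fun x : ℕ => ∑ n ∈ range x, (μ (n + h i₀) : ℝ) *
        (if ∀ i, ∀ d ∈ Icc 2 P, ¬ d ^ 2 ∣ n + h i then 1 else 0)) =o[atTop]
      fun x => (x : ℝ) := by
  classical
  set Q : ℕ := (P.factorial) ^ 2 with hQ_def
  have hQpos : 0 < Q := by positivity
  have hQdvd : ∀ d ∈ Icc 2 P, d ^ 2 ∣ Q := fun d hd =>
    pow_dvd_pow_of_dvd (Nat.dvd_factorial (by linarith [(mem_Icc.1 hd).1]) (mem_Icc.1 hd).2) 2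
  have hdecomp : ∀ x, ∑ n ∈ range x, (μ (n + h i₀) : ℝ) *
        (if ∀ i, ∀ d ∈ Icc 2 P, ¬ d ^ 2 ∣ n + h i then 1 else 0)
      = ∑ r ∈ range Q, (if ∀ i, ∀ d ∈ Icc 2 P, ¬ d ^ 2 ∣ r + h i then (1 : ℝ) else 0) *
          ∑ n ∈ (range x).filter (fun n => n % Q = r), (μ (n + h i₀) : ℝ) := by
    intro x
    rw [← Finset.sum_fiberwise_of_maps_to (g := fun n => n % Q) (t := range Q)
      (fun n _ => mem_range.2 (Nat.mod_lt n hQpos))]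
    refine Finset.sum_congr rfl fun r _ => ?_
    rw [Finset.mul_sum]
    refine Finset.sum_congr rfl fun n hn => ?_
    have hnr : n % Q = r := (mem_filter.1 hn).2
    rw [mul_comm]
    congr 1
    refine if_congr ?_ rfl rfl
    rw [sifted_iff_mod h hQdvd n, hnr]
  refine (IsLittleO.sum fun r hr => ?_).congr' (Eventually.of_forall fun x => (hdecomp x).symm)
    EventuallyEq.rfl
  exact (ChowlaKOne.isLittleO_sum_moebius_progression hQpos (mem_range.1 hr) (h i₀)).const_mul_left _

/-! ### Assembly -/

/-- `√(x + c) ≤ δ x` eventually (`δ > 0`). [folklore] -/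
theorem eventually_natSqrt_le (c : ℕ) {δ : ℝ} (hδ : 0 < δ) :
    ∀ᶠ x : ℕ in atTop, ((Nat.sqrt (x + c) : ℕ) : ℝ) ≤ δ * x := by
  obtain ⟨N, hN⟩ := exists_nat_ge (2 / δ ^ 2)
  filter_upwards [eventually_ge_atTop (max c N)] with x hx
  have hxc : c ≤ x := le_trans (le_max_left _ _) hx
  have hxN : (2 / δ ^ 2 : ℝ) ≤ x :=
    hN.trans (by exact_mod_cast le_trans (le_max_right _ _) hx)
  have hs : Nat.sqrt (x + c) * Nat.sqrt (x + c) ≤ x + c := Nat.sqrt_le (x + c)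
  have hx0 : (0 : ℝ) ≤ x := Nat.cast_nonneg x
  rw [mul_self_le_mul_self_iff (Nat.cast_nonneg _) (by positivity)]
  have h1 : ((Nat.sqrt (x + c) : ℕ) : ℝ) * (Nat.sqrt (x + c) : ℕ) ≤ (x : ℝ) + c := by
    exact_mod_cast hs
  have hc' : (c : ℝ) ≤ x := by exact_mod_cast hxc
  have h2 : 2 ≤ δ ^ 2 * x := by
    rw [div_le_iff₀ (by positivity)] at hxN
    linarith
  nlinarith [mul_le_mul_of_nonneg_right h2 hx0]

end ChowlaOneOdd

/-- **Chowla's conjecture in Möbius sign-pattern form holds when exactly one exponent is odd**: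
for any shifts `h : Fin k → ℕ` (distinct or not) and exponents with `a_{i₀} = 1` and `a_i = 2`
for `i ≠ i₀`, `∑_{n<x} ∏_i μ(n + h_i)^{a_i} = ∑_{n<x} μ(n+h_{i₀}) ∏_{i≠i₀} μ²(n+h_i) = o(x)`.
This is the classical "known case" of `MoebiusChowlaConjecture`: the `μ²` factors only impose
squarefreeness, which is detected up to `o(1)` density by the squares `d² ≤ P²`, a condition
periodic modulo `(P!)²`; on each residue class the sum is a shifted sum of `μ` over an
arithmetic progression, `o(x)` by the prime number theorem for `μ` in progressions
(`ChowlaKOne.isLittleO_sum_moebius_progression`, from the tree's proved Siegel–Walfisz theorem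
for `μ`, Montgomery–Vaughan §11.3 Exercise 13(f)); the exceptional `n` (some `n + h_i` divisible
by `d²`, `d > P`) number `≤ ∑_i (2x/(P+1) + √(x+h_i))` (`card_exceptional_le`). Printed form of
the reduction "`μ²` factors are harmless": Ramaré, *Chowla's conjecture: from the Liouville
function to the Moebius function*, Lemma 16.10 and Theorem 16.8 (Conjecture 16.4 ⇒ 16.6), whose
case `|I| = 1` is `∑_{n≤x} μ(an+b) = o(x)`, the prime number theorem for `μ` in arithmetic
progressions (here Montgomery–Vaughan §11.3 Exercise 13(f); for the Liouville analogue
`∑_{n≤x} λ(an+b) = o(x)` "is equivalent to the prime number theorem in arithmetic progressions by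
an elementary argument", Tao–Teräväinen, JTNB 30 (2018), §1). Every case of
`MoebiusChowlaConjecture` with two or more odd exponents (`k ≥ 2`, distinct shifts) is OPEN.
[cite: Ramare2018ChowlaLiouvilleMoebius, Lemma 16.10 and Theorem 16.8] -/
theorem moebiusChowlaConjecture_oneOdd {k : ℕ} (h a : Fin k → ℕ) (i₀ : Fin k) (ha : a i₀ = 1)
    (ha' : ∀ i, i ≠ i₀ → a i = 2) :
    (fun x : ℕ => (moebiusCorrelation h a x : ℝ)) =o[atTop] fun x => (x : ℝ) := by
  have hk : (0 : ℝ) < k := by exact_mod_cast Fin.pos i₀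
  have hcorr : ∀ x, (moebiusCorrelation h a x : ℝ) =
      ∑ n ∈ range x, (μ (n + h i₀) : ℝ) * (if ∀ i, Squarefree (n + h i) then 1 else 0) := by
    intro x
    simp only [moebiusCorrelation, Int.cast_sum, Int.cast_prod, Int.cast_pow]
    exact Finset.sum_congr rfl fun n _ => ChowlaOneOdd.prod_pow_eq h a i₀ ha ha' n
  refine Asymptotics.isLittleO_iff.2 fun ε hε => ?_
  -- the sifting level `P`: `2k/(P+1) ≤ ε/2`
  obtain ⟨P, hP2, hPε⟩ : ∃ P : ℕ, 2 ≤ P ∧ 2 * (k : ℝ) / ((P : ℝ) + 1) ≤ ε / 2 := by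
    obtain ⟨P₀, hP₀⟩ := exists_nat_ge (4 * k / ε)
    refine ⟨max P₀ 2, le_max_right _ _, ?_⟩
    have hP : (4 * k / ε : ℝ) ≤ ((max P₀ 2 : ℕ) : ℝ) :=
      hP₀.trans (by exact_mod_cast le_max_left _ _)
    rw [div_le_iff₀ hε] at hP
    rw [div_le_iff₀ (by positivity)]
    nlinarith
  -- the main term and the square roots are eventually small
  have hmain := (ChowlaOneOdd.main_isLittleO h i₀ P).def (show (0 : ℝ) < ε / 4 by positivity)
  have hsq : ∀ᶠ x : ℕ in atTop, ∀ i, ((Nat.sqrt (x + h i) : ℕ) : ℝ) ≤ ε / (4 * k) * x :=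
    eventually_all.2 fun i => ChowlaOneOdd.eventually_natSqrt_le (h i) (by positivity)
  filter_upwards [hmain, hsq] with x hxm hxs
  rw [Real.norm_eq_abs, Real.norm_eq_abs, Nat.abs_cast] at hxm ⊢
  have hx0 : (0 : ℝ) ≤ x := Nat.cast_nonneg x
  rw [hcorr]
  -- split off the sifted main term
  have hsplit : ∑ n ∈ range x, (μ (n + h i₀) : ℝ) * (if ∀ i, Squarefree (n + h i) then 1 else 0)
      = ∑ n ∈ range x, (μ (n + h i₀) : ℝ) *
          (if ∀ i, ∀ d ∈ Icc 2 P, ¬ d ^ 2 ∣ n + h i then 1 else 0) +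
        ∑ n ∈ range x, (μ (n + h i₀) : ℝ) *
          ((if ∀ i, Squarefree (n + h i) then 1 else 0) -
            (if ∀ i, ∀ d ∈ Icc 2 P, ¬ d ^ 2 ∣ n + h i then 1 else 0)) := by
    rw [← Finset.sum_add_distrib]
    exact Finset.sum_congr rfl fun n _ => by ring
  -- the error is at most the number of exceptional `n`
  have herr : |∑ n ∈ range x, (μ (n + h i₀) : ℝ) *
      ((if ∀ i, Squarefree (n + h i) then 1 else 0) -
        (if ∀ i, ∀ d ∈ Icc 2 P, ¬ d ^ 2 ∣ n + h i then 1 else 0))| ≤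
      #((range x).filter (fun n => ∃ i, ∃ d ∈ Ioc P (Nat.sqrt (x + h i)), d ^ 2 ∣ n + h i)) := by
    rw [← Finset.sum_boole]  -- `#filter = ∑ indicator`
    refine (Finset.abs_sum_le_sum_abs _ _).trans (Finset.sum_le_sum fun n hn => ?_)
    have hnx : n < x := mem_range.1 hn
    rw [abs_mul]
    by_cases hT : ∀ i, Squarefree (n + h i)
    · have hTP : ∀ i, ∀ d ∈ Icc 2 P, ¬ d ^ 2 ∣ n + h i := fun i => ChowlaOneOdd.sifted_of_squarefree (hT i)
      rw [if_pos hT, if_pos hTP, sub_self, abs_zero, mul_zero]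
      positivity
    · by_cases hTP : ∀ i, ∀ d ∈ Icc 2 P, ¬ d ^ 2 ∣ n + h i
      · have hE : ∃ i, ∃ d ∈ Ioc P (Nat.sqrt (x + h i)), d ^ 2 ∣ n + h i := by
          obtain ⟨i, hi⟩ := not_forall.1 hT
          obtain ⟨d, hPd, hdle, hdvd⟩ := ChowlaOneOdd.exists_of_sifted_not_squarefree hP2 (hTP i) hi
          exact ⟨i, d, mem_Ioc.2 ⟨hPd, hdle.trans (Nat.sqrt_le_sqrt (by omega))⟩, hdvd⟩
        rw [if_neg hT, if_pos hTP, if_pos hE, zero_sub, abs_neg, abs_one, mul_one]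
        exact_mod_cast ArithmeticFunction.abs_moebius_le_one
      · rw [if_neg hT, if_neg hTP, sub_self, abs_zero, mul_zero]
        positivity
  have hcount := ChowlaOneOdd.card_exceptional_le h P x
  have hsum_sqrt : ∑ i, (2 * (x : ℝ) / ((P : ℝ) + 1) + Nat.sqrt (x + h i)) ≤
      ε / 2 * x + ε / 4 * x := by
    rw [Finset.sum_add_distrib, Finset.sum_const, Finset.card_univ, Fintype.card_fin,
      nsmul_eq_mul]
    refine add_le_add ?_ ?_
    · calc (k : ℝ) * (2 * (x : ℝ) / ((P : ℝ) + 1)) = 2 * (k : ℝ) / ((P : ℝ) + 1) * x := by ring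
        _ ≤ ε / 2 * x := mul_le_mul_of_nonneg_right hPε hx0
    · calc ∑ i, ((Nat.sqrt (x + h i) : ℕ) : ℝ) ≤ ∑ _i : Fin k, ε / (4 * k) * x :=
            Finset.sum_le_sum fun i _ => hxs i
        _ = ε / 4 * x := by
            rw [Finset.sum_const, Finset.card_univ, Fintype.card_fin, nsmul_eq_mul]
            field_simp
  rw [hsplit]
  calc |∑ n ∈ range x, (μ (n + h i₀) : ℝ) *
          (if ∀ i, ∀ d ∈ Icc 2 P, ¬ d ^ 2 ∣ n + h i then 1 else 0) +
        ∑ n ∈ range x, (μ (n + h i₀) : ℝ) *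
          ((if ∀ i, Squarefree (n + h i) then 1 else 0) -
            (if ∀ i, ∀ d ∈ Icc 2 P, ¬ d ^ 2 ∣ n + h i then 1 else 0))|
      ≤ ε / 4 * x + (ε / 2 * x + ε / 4 * x) :=
        (abs_add_le _ _).trans (add_le_add hxm ((herr.trans hcount).trans hsum_sqrt))
    _ = ε * x := by ring


/-- `MoebiusChowlaConjecture` restricted to the sign patterns with exactly one exponent equal to
`1`, in the binder shape of the definition (injectivity of the shifts is not needed): PROVED,
`moebiusChowlaConjecture_oneOdd`. [cite: Ramare2018ChowlaLiouvilleMoebius, Lemma 16.10 and Theorem 16.8] -/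
theorem moebiusChowlaConjecture_of_existsUnique :
    ∀ (k : ℕ) (h a : Fin k → ℕ), Function.Injective h → (∀ i, a i = 1 ∨ a i = 2) →
      (∃! i, a i = 1) →
      (fun x : ℕ => (moebiusCorrelation h a x : ℝ)) =o[atTop] fun x => (x : ℝ) := by
  intro k h a _ ha12 hex
  obtain ⟨i₀, hi₀, huniq⟩ := hex
  refine moebiusChowlaConjecture_oneOdd h a i₀ hi₀ fun i hi => ?_
  rcases ha12 i with h1 | h2
  · exact absurd (huniq i h1) hi
  · exact h2

/-- **The case `k = 1` of Chowla's conjecture in Möbius sign-pattern form holds**: for a single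
shift `h₀` the exponent pattern must be `a₀ = 1`, and `∑_{n<x} μ(n + h₀) = o(x)` — the prime
number theorem for `μ` (Landau; "If `f(x) = x` this is equivalent to the Prime Number Theorem",
Chowla 1965, Ch. 8); the instance `k = 1` of `moebiusChowlaConjecture_oneOdd`.
`MoebiusChowlaConjecture` itself (all `k`) is open for every `k ≥ 2` (Tao–Teräväinen 2022,
§1.1), which is why no `MoebiusChowlaConjecture_holds` exists.
[cite: Chowla1965Book, Ch. 8, Problem 57, eq. (341) ("If f(x) = x this is equivalent to the Prime Number Theorem")] -/
theorem moebiusChowlaConjecture_one (h a : Fin 1 → ℕ) (ha : ∃ i, a i = 1) :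
    (fun x : ℕ => (moebiusCorrelation h a x : ℝ)) =o[atTop] fun x => (x : ℝ) := by
  obtain ⟨i, hi⟩ := ha
  have ha0 : a 0 = 1 := by rwa [Fin.fin_one_eq_zero i] at hi
  exact moebiusChowlaConjecture_oneOdd h a 0 ha0 fun i hi => absurd (Fin.fin_one_eq_zero i) hi

/-- **The case `k = 1` of Chowla's conjecture (Liouville form) holds**: for a single shift `h₀`,
`∑_{n<x} λ(n + h₀) = o(x)`. "If `f(x) = x` this is equivalent to the Prime Number Theorem"
(Chowla 1965, Ch. 8); here from the tree's unconditional bound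
`Literature.NumberTheory.LFunctions.abs_sum_liouville_le_logPow`. This is the only `k` for which
`ChowlaConjecture` is known (open for every `k ≥ 2`, Matomäki–Radziwiłł–Tao 2015, §1).
[cite: Chowla1965Book, Ch. 8, Problem 57, eq. (341) ("If f(x) = x this is equivalent to the Prime Number Theorem")] -/
theorem chowlaConjecture_one (h : Fin 1 → ℕ) :
    (fun x : ℕ => (liouvilleCorrelation h x : ℝ)) =o[atTop] fun x => (x : ℝ) := by
  have hF := ChowlaKOne.isLittleO_sum_range_of_logBound
    (f := fun n => (ArithmeticFunction.liouville n : ℝ)) (by simp)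
    (let ⟨C, hC⟩ := Literature.NumberTheory.LFunctions.abs_sum_liouville_le_logPow 1
     ⟨C, 2, hC⟩)
  refine (ChowlaKOne.isLittleO_sum_range_add hF (h 0)).congr' (Eventually.of_forall fun x => ?_)
    EventuallyEq.rfl
  simp only [liouvilleCorrelation, Fin.prod_univ_one, Int.cast_sum]

/-- The `k = 1` instance of `ChowlaConjecture` in exactly the binder shape of the definition.
[cite: Chowla1965Book, Ch. 8, Problem 57, eq. (341)] -/
theorem chowlaConjecture_of_k_eq_one :
    ∀ (h : Fin 1 → ℕ), 0 < 1 → Function.Injective h →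
      (fun x : ℕ => (liouvilleCorrelation h x : ℝ)) =o[atTop] fun x => (x : ℝ) :=
  fun h _ _ => chowlaConjecture_one h

end Literature.NumberTheory.Sieve
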